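import Summits.QuantumFields.YangMills.Theorems.BalabanUVNodesN07SymPhiTorusRowAtRecordCubeCell
import Summits.QuantumFields.YangMills.Theorems.BalabanUVNodesN07DatumCrownSideConditions
import HarnessLib

/-!
# N07 [B11] (= [15] = [Balaban1985Variational]) Sect. F ∕ [I] (0.3)–(0.4), (0.21) ∕ [3] (78)–(81) ∕ [6] (1.29), (1.131) — **THE JUNCTION's BLOCK-CONSTANT DATUM `(h, X, ω)` AT A DENTED
# RECORD CUBE**: when the two axial tower gauges agree on `T^{(k)}` (residual carriers, the SAME rooted top gauge), the lift `τ` of `g₁·g₂⁻¹` is within `ω_τ` of `1` on ALL of `□̃ᶻ`, the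
# cell data `X(j′,y) := R̄₀^{j′}τ(y)` are within `9ω_τ` of `1`, and the realising block-constant `h` (n05-e ✓p748893) is `SU(N)`-valued, `= 1` off `Ω′₀`, `= X` under every dented cell, with
# BOTH oscillation rows of the pre-composed crown (`hoscj`, `hosc0`) at `ω := 18ω_τ` — the first seven conjuncts of the junction's `hJ` (✓p760315) and the `hh` binder of ✓p760822

Cell `pub-ymgap`, width seat `pub-ymgap-dag-n07-w3` g14 (junction owner of the K0 road; (σ1) pen of record, director-ym №330; INTENT-34).  `--kind proof --supports stmt-QuantumFields-20541
--as helper` (K0⁷; count-neutral; 0 `def`).  [I] = [Balaban1987RG1]; [3] = [Balaban1985Averaging]; [6] = [Balaban1985RegularSpaces]; [15] = [Balaban1985Variational].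

WHY.  The junction's closing file (`hJ` of ✓p760315, JUNCTION-PHI-ROAD §12) must CHOOSE, per datum, a block-constant `h` with the crown's two oscillation rows and `h ≡ R̄₀^{j′}τ(y)` under every
dented cell (`hh` of ✓p760822).  Both carriers are RESIDUAL of level `k` and carry the SAME rooted top gauge `h̄ = blockLift k (axialGaugeAt (M^k U) …)` (a residual `w` does not move `M^k`:
✓`N07TowerGaugeCoverLift.iter_gaugeAct_eq_of_residual`), so `τ_T := g₁·g₂⁻¹ = h̄·w_s·w_r⁻¹·h̄⁻¹` IS `1` ON `T^{(k)}` — displayed here as `htop` — and the (σ2) pointwise oscillation of the lift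
under every top block of `□̃` (✓p758311 §3 at `Y := □̃`, INTENT-28's `tcube_aligned`) puts `τ` within `ω_τ` of `1` on the whole of `□̃ᶻ`; the cell averages follow by ✓p753816's near-centre row.
So the datum is nearly trivial (`h ≈ 1`), its oscillation rows hold with `ω := 18ω_τ` WITHOUT any box hypothesis, while `h ≡ R̄₀^{j′}τ(y)` exactly keeps the cross term second order.

WHAT IS PROVED (sorry-free; axioms standard).  §1 `norm_sub_one_le_of_inv_mul` (unit-ball algebra); ★★ `norm_lift_tau_sub_one_le_of_top` — `‖τ_Z(w) − 1‖ ≤ ω_τ` for every `w ∈ □̃ᶻ`.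
§2 ★★ `uavgZ_tau_unitary_and_near_one_at_cell` — at a dented cell `y ∈ Λ′_{j′}` (`j′ ≤ k`): `R̄₀^{j′}τ(y)` unitary and `‖R̄₀^{j′}τ(y) − 1‖ ≤ 9ω_τ`; ★ `uavgZ_tau_eq_gaugeAvgIter_at_cell` —
it IS `ι(R̄^{j′}τ_T(π_{j′}(y + c_{k−j′}𝟙)))` (FILE 40c guard release under `4ω_τ < δ_N`), hence special-unitary (used in §3).
§3 ★★★ `exists_junction_blockConstant_datum` — the `(h, X, ω)` package: `h` `SU(N)`-valued, `= 1` off `Ω′₀`, `= R̄₀^{j′}τ(y)` under every dented cell (`j′ ≤ k`), `‖h − 1‖ ≤ 9ω_τ`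
everywhere, and the two rows `‖h(L^{j′}z) − h(L^{j′}(z + e_μ))‖ ≤ 18ω_τ` (all `j′, z, μ`) ∕ `‖h(x) − h(x + e_μ)‖ ≤ 18ω_τ` (all bonds) — in particular `hoscj`∕`hosc0` of `hJ` verbatim.
HONEST FRAMING: count-neutral helper; composition of landed names (✓p758311 §3, ✓p759262, ✓p753816, ✓p748893, FILE 40c); the torus inputs (collar, one fine letter, two axialities,
`htop`, numerics) stay DISPLAYED; nothing of [I]∕[3]∕[6]∕[15] asserted anew; `hJ` ∕ `DatumCrownPhiAt` ∕ `hsup` ∕ HSEAM inhabited by nobody; `HThm4RecSym152PhiEG` ∕ `HThm4Rec*` UNDISCHARGED;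
N05 ∕ N07 NOT discharged; K0⁷ ∕ K1⁹ NOT closed; counts unmoved; one finite 𝕋⁴ programme at fixed ε — R4 closes the conditional finite-𝕋⁴ rung `BalabanLadder.UV` only; the YM mass gap (Clay)
is NOT proved by any of this; nothing continuum ∕ ℝ⁴ ∕ OS.  No `def`, no `instance`, no `notation`, no `sorry`.

References: [I] (0.1) p. 251, (0.3)–(0.4) pp. 252–253, (0.21) p. 256; [3] (78)–(81) p. 30, (167) p. 44; [6] (1.29) p. 81, p. 98, (1.131) p. 99; [15] (147)–(154) pp. 301–302.
-/

set_option autoImplicit false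

noncomputable section

open scoped BigOperators Matrix.Norms.L2Operator

namespace Summit.QuantumFields.YangMills.BalabanUVNodes.N07JunctionBlockConstantDatum

open Literature.MathematicalPhysics.QuantumFieldTheory.Balaban1983to89
open Literature.MathematicalPhysics.QuantumFieldTheory.Balaban1983to89.Node00
open Literature.MathematicalPhysics.QuantumLattice (blockMap)
open T4Continuum (T4Family)
open B14DomainGeom (Pt)
open GaugeField (gaugeAct)
open ExpMeanLog (expMeanLogSU deltaSU)
open BlockAveragingZd (ctrShift offZ)
open B8Eq119TwistedAxialRec (UnderZ underZ_zero_iff)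
open B8BlockConstantLiftStabilityRec (underZ_pow_smul)
open B8BlockConstantLiftDentedRec (mem_sq_zero_of_underZ_lamS exists_blockConstant_dented)
open B15Eq112TorusCover (cover)
open B7Prop1Explicit (U1 e)
open B7Prop2Explicit (unitaryUnits unitaryUnits_le_U1)
open B7Prop2SpecialUnitary (specialUnitaryUnits specialUnitaryUnits_le_unitaryUnits)
open B7AvgGaugeCovariance (uLev)
open B7SectCDGaugeAveragesRec (uavgZ)
open B7SectEFLinearisationRec (mem_blockSitesZ)
open B8Eq17ClassAkV1 (plaqsOf)
open B8Eq131Cubes (tcube)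
open B8Eq131CubesRec (tcubeZ)
open B8Eq131CubesRecDictionary (mem_tcubeZ_iff_add_ctrShift)
open B8ExpMeanLogOscFromPointwiseRec (osc_rows_of_pointwise_under uavgZ_one_unitary_and_near_centre_under)
open Summit.QuantumFields.Balaban3D.Carriers (radialContourData)
open Summit.QuantumFields.YangMills.BalabanUVNodes.N07NormalisationSymOfRecord (symCd)
open Summit.QuantumFields.YangMills.BalabanUVNodes.N07TowerOscCoverBridge (lift_mem_unitaryUnits_under)
open Summit.QuantumFields.YangMills.BalabanUVNodes.N07SymTauCellRowOfFinePlaquettes (hpt_lift_of_fineLetter_aligned)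
open Summit.QuantumFields.YangMills.BalabanUVNodes.N07RecordCubeTowerWindow (hpt_lift_at_recordCube_cell tcube_aligned underZ_sub_anchor_of_blockMap_pow)
open Summit.QuantumFields.YangMills.BalabanUVNodes.N07DatumCrownSideConditions (ιSU_mem_specialUnitaryUnits)
open Literature.MathematicalPhysics.QuantumFieldTheory.Balaban1983to89.B15DeterminingSets (embIter)

variable {F : T4Family} (N : ℕ) [NeZero N]

/-! ## §1  `τ` is within `ω_τ` of `1` on the whole of `□̃ᶻ` -/

/-- Unit-ball algebra: `‖B − 1‖ ≤ ‖A⁻¹B − 1‖ + ‖A − 1‖` for `A ∈ U1` (`B − 1 = A·(A⁻¹B − 1) + (A − 1)`). [cite: Balaban1985Averaging, (45) p.24 (bookkeeping)] -/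
theorem norm_sub_one_le_of_inv_mul (A B : (MatA N)ˣ) (hA : A ∈ U1 (MatA N)) :
    ‖(B : MatA N) - 1‖ ≤ ‖(((A⁻¹ * B : (MatA N)ˣ)) : MatA N) - 1‖ + ‖(A : MatA N) - 1‖ := by
  have hsplit : (B : MatA N) - 1 = (A : MatA N) * ((((A⁻¹ * B : (MatA N)ˣ)) : MatA N) - 1) + ((A : MatA N) - 1) := by
    rw [Units.val_mul, mul_sub, ← mul_assoc, ← Units.val_mul, mul_inv_cancel, Units.val_one, one_mul, mul_one]
    abel
  rw [hsplit]
  calc ‖(A : MatA N) * ((((A⁻¹ * B : (MatA N)ˣ)) : MatA N) - 1) + ((A : MatA N) - 1)‖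
      ≤ ‖(A : MatA N) * ((((A⁻¹ * B : (MatA N)ˣ)) : MatA N) - 1)‖ + ‖(A : MatA N) - 1‖ := norm_add_le _ _
    _ ≤ ‖(A : MatA N)‖ * ‖(((A⁻¹ * B : (MatA N)ˣ)) : MatA N) - 1‖ + ‖(A : MatA N) - 1‖ := by gcongr; exact norm_mul_le _ _
    _ ≤ 1 * ‖(((A⁻¹ * B : (MatA N)ˣ)) : MatA N) - 1‖ + ‖(A : MatA N) - 1‖ := by gcongr; exact hA.1
    _ = _ := by rw [one_mul]

/-- ★★ **`τ` IS WITHIN `ω_τ` OF `1` ON THE WHOLE OF `□̃ᶻ`**: for a dented record cube `c` (`c.k ≤ m + K`) and two gauges `g₁, g₂` with the torus inputs of ✓p758311 §3 at `Y := □̃` (collar,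
one fine letter, `symCd`∕radial axialities below `c.k`, the numerics and the geometric schedule with `θ ≤ 1∕2`) which AGREE ON `T^{(k)}` (`g₁·g₂⁻¹ = 1` at every `embIter k`-site — both
residual with the same rooted top gauge), the anchored lift `τ_Z := ι∘(g₁·g₂⁻¹)∘π∘(· + c_k𝟙)` obeys `‖τ_Z(w) − 1‖ ≤ ω` at every `w ∈ □̃ᶻ = tcubeZ L c.a c.M c.ρ c.k` — the top block of `w` has
its anchored box in `□̃` (`tcube_aligned`), its centre is an `embIter k`-site (`embIter_coverAt`), and the pointwise oscillation under it at the top scale is `ω·θ⁰`.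
[cite: Balaban1987RG1, (0.1) p.251, (0.3)–(0.4) pp.252–253, (0.21) p.256; Balaban1985Averaging, (167) p.44; Balaban1985RegularSpaces, p.98, (1.15) p.78; Balaban1985Variational, (147) p.301] -/
theorem norm_lift_tau_sub_one_le_of_top {K K' : ℕ} {Ω' : ℕ → Set (B7Prop1Explicit.Site (F.P K).d)} (c : CubeB8DZ (F.P K).d (F.P K).L K' Ω')
    (hk : c.k ≤ (F.P K).m + (F.P K).K) (U : GaugeField (F.P K) 0 (SU N)) (g₁ g₂ : GaugeTransf (F.P K) 0 (SU N))
    (hax₁ : ∀ n, n < c.k → AxialGauge (symCd F N K n) (Averaging.iter (avOfRecord F N K) n (gaugeAct g₁ U)))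
    (hax₂ : ∀ n, n < c.k → AxialGauge (radialContourData (F.P K) n (SU N)) (Averaging.iter (avOfRecord F N K) n (gaugeAct g₂ U)))
    (htop : ∀ yT : Site (F.P K) c.k, g₁ (embIter c.k yT) * (g₂ (embIter c.k yT))⁻¹ = 1)
    (hN : ∀ n, n < c.k → (F.P K).L < (F.P K).sitesPerDir n)
    {a₀ : ℝ} (ha₀ : 0 ≤ a₀) {Ωc : Set (Site (F.P K) 0)} (hU : PlaqSmallOn (plaqsOf Ωc) a₀ U)
    (hcollar : cover (F.P K) '' tcube (F.P K).L c.a c.M c.ρ c.k ⊆ Ωc)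
    (a : ℕ → ℝ) (ha : ∀ n, 0 ≤ a n)
    (hbud : ∀ n, n < c.k →
      6400 * ((((F.P K).d + 2) * (F.P K).L : ℕ) : ℝ) ^ 2 * ((F.P K).L : ℝ) ^ (n + 1) * (((((F.P K).d - 1 : ℕ) : ℝ)) * ((((F.P K).L ^ (n + 1) - 1 : ℕ) : ℝ)) * a₀) ≤ 1)
    (hgd : ∀ n, n < c.k →
      30 * ((((F.P K).d + 2) * (F.P K).L : ℕ) : ℝ) ^ 2 * ((F.P K).L : ℝ) ^ (n + 1) * (((((F.P K).d - 1 : ℕ) : ℝ)) * ((((F.P K).L ^ (n + 1) - 1 : ℕ) : ℝ)) * a₀) < deltaSU (Fin N))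
    (haa : ∀ n, n < c.k →
      120 * ((((F.P K).d + 2) * (F.P K).L : ℕ) : ℝ) * ((F.P K).L : ℝ) ^ n * (((((F.P K).d - 1 : ℕ) : ℝ)) * ((((F.P K).L ^ (n + 1) - 1 : ℕ) : ℝ)) * a₀) < a n)
    (h100 : ∀ n, n < c.k → 2 * ((((F.P K).d * (((F.P K).L - 1) / 2) : ℕ) : ℝ) * (((((F.P K).d - 1 : ℕ) : ℝ) * (((F.P K).L - 1 : ℕ) : ℝ)) * a n)) ≤ 1 / 100)
    (hguard : ∀ n, n < c.k →
      2 * ((((F.P K).d * (((F.P K).L - 1) / 2) : ℕ) : ℝ) * (((((F.P K).d - 1 : ℕ) : ℝ) * (((F.P K).L - 1 : ℕ) : ℝ)) * a n)) < (FederbushMean.federbushSU (n := Fin N)).δ)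
    {ω θ : ℝ} (hθ0 : 0 ≤ θ) (hθ : θ ≤ 1 / 2) (hω0 : 0 ≤ ω)
    (hE : ∀ m, m < c.k → 4 * (2 * ((((F.P K).d * (((F.P K).L - 1) / 2) : ℕ) : ℝ) * (((((F.P K).d - 1 : ℕ) : ℝ) * (((F.P K).L - 1 : ℕ) : ℝ)) * a m))) ≤
      ω / 2 * θ ^ (c.k - (m + 1)))
    {w : Pt (F.P K).d} (hw : w ∈ tcubeZ (F.P K).L c.a c.M c.ρ c.k) :
    ‖(((fun x => ιSU N ((fun x' => g₁ x' * (g₂ x')⁻¹) (cover (F.P K) (x + fun _ => ((ctrShift (F.P K).L c.k : ℕ) : ℤ))))) w : (MatA N)ˣ) : MatA N) - 1‖ ≤ ω := by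
  have hL := (F.P K).hL.1
  have hk1 := c.one_le_k
  set τZ : Pt (F.P K).d → (MatA N)ˣ := (fun x => ιSU N ((fun x' => g₁ x' * (g₂ x')⁻¹) (cover (F.P K) (x + fun _ => ((ctrShift (F.P K).L c.k : ℕ) : ℤ))))) with hτZ
  -- the top block of `w`: its anchored point, its label, its anchored box in `□̃`
  set x₀ : Pt (F.P K).d := w + fun _ => ((ctrShift (F.P K).L c.k : ℕ) : ℤ) with hx₀
  have hx₀T : x₀ ∈ tcube (F.P K).L c.a c.M c.ρ c.k := (mem_tcubeZ_iff_add_ctrShift hL c.a c.M c.ρ c.k w).1 hw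
  set Y : Pt (F.P K).d := blockMap ((F.P K).L ^ c.k) x₀ with hY
  have hc0 : (fun _ => ((ctrShift (F.P K).L (c.k - c.k) : ℕ) : ℤ)) = (0 : Pt (F.P K).d) := by
    funext μ; simp [ctrShift]
  have hYeq : blockMap ((F.P K).L ^ c.k) x₀ = Y + fun _ => ((ctrShift (F.P K).L (c.k - c.k) : ℕ) : ℤ) := by rw [hc0, add_zero]
  have hyY : {x : Pt (F.P K).d | blockMap ((F.P K).L ^ c.k) x = Y + fun _ => ((ctrShift (F.P K).L (c.k - c.k) : ℕ) : ℤ)} ⊆ tcube (F.P K).L c.a c.M c.ρ c.k := by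
    intro x hx
    rw [Set.mem_setOf_eq, ← hYeq] at hx
    exact tcube_aligned c.a c.M c.ρ c.k x₀ hx₀T x hx
  have hpt := hpt_lift_of_fineLetter_aligned N hk U g₁ g₂ hax₁ hax₂ hN ha₀ hU (tcube_aligned c.a c.M c.ρ c.k) hcollar a ha hbud hgd haa h100 hguard hθ0 hθ hω0 hE
    (le_refl c.k) Y hyY
  -- `w` is under `Y` at the top scale
  have hwY : UnderZ (F.P K).L c.k Y w := by
    have h := underZ_sub_anchor_of_blockMap_pow (P := F.P K) (le_refl c.k) hYeq
    rwa [hx₀, add_sub_cancel_right] at h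
  have hkk : c.k - 1 + 1 = c.k := by omega
  have h1 := hpt (c.k - 1) (by omega) Y (by rw [hkk, Nat.sub_self]; exact (underZ_zero_iff (F.P K).L Y Y).2 rfl) w (by rw [hkk]; exact hwY)
  rw [hkk, Nat.sub_self, pow_zero, mul_one] at h1
  have h1' : ‖((((τZ ((((F.P K).L : ℤ) ^ c.k) • Y))⁻¹ * τZ w : (MatA N)ˣ)) : MatA N) - 1‖ ≤ ω := h1
  -- the centre of the top block is an `embIter k`-site, where `τ = 1`
  have hcentre : τZ ((((F.P K).L : ℤ) ^ c.k) • Y) = 1 := by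
    have hpt' : ((((F.P K).L : ℤ) ^ c.k) • Y + fun _ => ((ctrShift (F.P K).L c.k : ℕ) : ℤ)) =
        fun μ => ((F.P K).L : ℤ) ^ c.k * Y μ + (((F.P K).L ^ c.k - 1) / 2 : ℕ) := by
      funext μ; rfl
    show ιSU N (g₁ (cover (F.P K) ((((F.P K).L : ℤ) ^ c.k) • Y + fun _ => ((ctrShift (F.P K).L c.k : ℕ) : ℤ))) *
        (g₂ (cover (F.P K) ((((F.P K).L : ℤ) ^ c.k) • Y + fun _ => ((ctrShift (F.P K).L c.k : ℕ) : ℤ))))⁻¹) = 1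
    rw [hpt', ← embIter_coverAt hk Y, htop, map_one]
  rw [hcentre, inv_one, one_mul] at h1'
  exact h1'

/-! ## §2  The cell data `X(j′, y) := R̄₀^{j′}τ(y)` are unitary, special-unitary and within `9ω_τ` of `1` -/

/-- ★★ **THE CELL AVERAGE OF `τ` IS UNITARY AND WITHIN `9ω_τ` OF `1`**: under the hypotheses of §1 with `θ ≤ 1∕8`, `ω ≤ 1∕128`, at every dented cell `y ∈ Λ′_{j′}` (`c.lamS j′`, `j′ ≤ c.k`):
`R̄₀^{j′}τ(y) = uavgZ L 1 τ_Z j′ y` is unitary and `‖R̄₀^{j′}τ(y) − 1‖ ≤ 9ω` — ✓p753816's near-centre row at the cell (`≤ 8ω`, from the (σ2) pointwise oscillation ✓p759262 §4) plus §1 at the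
cell's centre `L^{j′}·y ∈ Ω′₀ ⊆ □̃ᶻ`. [cite: Balaban1985Averaging, (78)–(81) p.30, (167) p.44; Balaban1985RegularSpaces, (1.29) p.81, (1.131) p.99; Balaban1987RG1, (0.3)–(0.4) pp.252–253] -/
theorem uavgZ_tau_unitary_and_near_one_at_cell {K K' : ℕ} {Ω' : ℕ → Set (B7Prop1Explicit.Site (F.P K).d)} (c : CubeB8DZ (F.P K).d (F.P K).L K' Ω')
    (hk : c.k ≤ (F.P K).m + (F.P K).K) (U : GaugeField (F.P K) 0 (SU N)) (g₁ g₂ : GaugeTransf (F.P K) 0 (SU N))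
    (hax₁ : ∀ n, n < c.k → AxialGauge (symCd F N K n) (Averaging.iter (avOfRecord F N K) n (gaugeAct g₁ U)))
    (hax₂ : ∀ n, n < c.k → AxialGauge (radialContourData (F.P K) n (SU N)) (Averaging.iter (avOfRecord F N K) n (gaugeAct g₂ U)))
    (htop : ∀ yT : Site (F.P K) c.k, g₁ (embIter c.k yT) * (g₂ (embIter c.k yT))⁻¹ = 1)
    (hN : ∀ n, n < c.k → (F.P K).L < (F.P K).sitesPerDir n)
    {a₀ : ℝ} (ha₀ : 0 ≤ a₀) {Ωc : Set (Site (F.P K) 0)} (hU : PlaqSmallOn (plaqsOf Ωc) a₀ U)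
    (hcollar : cover (F.P K) '' tcube (F.P K).L c.a c.M c.ρ c.k ⊆ Ωc)
    (a : ℕ → ℝ) (ha : ∀ n, 0 ≤ a n)
    (hbud : ∀ n, n < c.k →
      6400 * ((((F.P K).d + 2) * (F.P K).L : ℕ) : ℝ) ^ 2 * ((F.P K).L : ℝ) ^ (n + 1) * (((((F.P K).d - 1 : ℕ) : ℝ)) * ((((F.P K).L ^ (n + 1) - 1 : ℕ) : ℝ)) * a₀) ≤ 1)
    (hgd : ∀ n, n < c.k →
      30 * ((((F.P K).d + 2) * (F.P K).L : ℕ) : ℝ) ^ 2 * ((F.P K).L : ℝ) ^ (n + 1) * (((((F.P K).d - 1 : ℕ) : ℝ)) * ((((F.P K).L ^ (n + 1) - 1 : ℕ) : ℝ)) * a₀) < deltaSU (Fin N))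
    (haa : ∀ n, n < c.k →
      120 * ((((F.P K).d + 2) * (F.P K).L : ℕ) : ℝ) * ((F.P K).L : ℝ) ^ n * (((((F.P K).d - 1 : ℕ) : ℝ)) * ((((F.P K).L ^ (n + 1) - 1 : ℕ) : ℝ)) * a₀) < a n)
    (h100 : ∀ n, n < c.k → 2 * ((((F.P K).d * (((F.P K).L - 1) / 2) : ℕ) : ℝ) * (((((F.P K).d - 1 : ℕ) : ℝ) * (((F.P K).L - 1 : ℕ) : ℝ)) * a n)) ≤ 1 / 100)
    (hguard : ∀ n, n < c.k →
      2 * ((((F.P K).d * (((F.P K).L - 1) / 2) : ℕ) : ℝ) * (((((F.P K).d - 1 : ℕ) : ℝ) * (((F.P K).L - 1 : ℕ) : ℝ)) * a n)) < (FederbushMean.federbushSU (n := Fin N)).δ)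
    {ω θ : ℝ} (hθ0 : 0 ≤ θ) (hθ : θ ≤ 1 / 8) (hω0 : 0 ≤ ω) (hω : ω ≤ 1 / 128)
    (hE : ∀ m, m < c.k → 4 * (2 * ((((F.P K).d * (((F.P K).L - 1) / 2) : ℕ) : ℝ) * (((((F.P K).d - 1 : ℕ) : ℝ) * (((F.P K).L - 1 : ℕ) : ℝ)) * a m))) ≤
      ω / 2 * θ ^ (c.k - (m + 1)))
    {j : ℕ} (hjk : j ≤ c.k) {y : Pt (F.P K).d} (hy : y ∈ c.lamS j) :
    letI : CStarAlgebra (MatA N) := {}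
    uavgZ (F.P K).L (1 : Pt (F.P K).d → Fin (F.P K).d → (MatA N)ˣ)
        (fun x => ιSU N ((fun x' => g₁ x' * (g₂ x')⁻¹) (cover (F.P K) (x + fun _ => ((ctrShift (F.P K).L c.k : ℕ) : ℤ))))) j y ∈ unitaryUnits (MatA N) ∧
      ‖((uavgZ (F.P K).L (1 : Pt (F.P K).d → Fin (F.P K).d → (MatA N)ˣ)
          (fun x => ιSU N ((fun x' => g₁ x' * (g₂ x')⁻¹) (cover (F.P K) (x + fun _ => ((ctrShift (F.P K).L c.k : ℕ) : ℤ))))) j y : (MatA N)ˣ) : MatA N) - 1‖ ≤ 9 * ω := by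
  letI : CStarAlgebra (MatA N) := {}
  have hL := (F.P K).hL.1
  have hθ2 : θ ≤ 1 / 2 := hθ.trans (by norm_num)
  set τZ : Pt (F.P K).d → (MatA N)ˣ := (fun x => ιSU N ((fun x' => g₁ x' * (g₂ x')⁻¹) (cover (F.P K) (x + fun _ => ((ctrShift (F.P K).L c.k : ℕ) : ℤ))))) with hτZ
  have hptτ := hpt_lift_at_recordCube_cell N c hk U g₁ g₂ hax₁ hax₂ hN ha₀ hU hcollar a ha hbud hgd haa h100 hguard hθ0 hθ2 hω0 hE hjk hy
  have hτu : ∀ x, UnderZ (F.P K).L j y x → τZ x ∈ unitaryUnits (MatA N) := lift_mem_unitaryUnits_under N (fun x' => g₁ x' * (g₂ x')⁻¹) c.k j y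
  obtain ⟨hunit, hnear⟩ := uavgZ_one_unitary_and_near_centre_under hL τZ j y hθ0 hθ hω0 hω hτu hptτ j le_rfl y
    (by rw [Nat.sub_self]; exact (underZ_zero_iff (F.P K).L y y).2 rfl)
  rw [Nat.sub_self, pow_zero, mul_one] at hnear
  refine ⟨hunit, ?_⟩
  -- the cell's centre lies in `Ω′₀ ⊆ □̃ᶻ`, where `τ` is within `ω` of `1`
  have hcT : ((((F.P K).L : ℤ) ^ j) • y) ∈ tcubeZ (F.P K).L c.a c.M c.ρ c.k :=
    CubeB8DZ.sq_zero_subset_tcube hL (F.P K).hL.2 c (mem_sq_zero_of_underZ_lamS hL c hjk hy (underZ_pow_smul (F.P K).L j y))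
  have hc1 := norm_lift_tau_sub_one_le_of_top N c hk U g₁ g₂ hax₁ hax₂ htop hN ha₀ hU hcollar a ha hbud hgd haa h100 hguard hθ0 hθ2 hω0 hE hcT
  have hc1' : ‖((τZ ((((F.P K).L : ℤ) ^ j) • y) : (MatA N)ˣ) : MatA N) - 1‖ ≤ ω := hc1
  have h := norm_sub_one_le_of_inv_mul N (τZ ((((F.P K).L : ℤ) ^ j) • y)) (uavgZ (F.P K).L (1 : Pt (F.P K).d → Fin (F.P K).d → (MatA N)ˣ) τZ j y)
    (unitaryUnits_le_U1 (hτu _ (underZ_pow_smul (F.P K).L j y)))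
  linarith

/-- ★ **THE CELL AVERAGE OF THE LIFT IS THE EMBEDDED TORUS AVERAGE** (FILE 40c guard release under the cell): with `θ ≤ 1∕8`, `ω ≤ 1∕128` and `4ω < δ_N`, at every dented cell
`y ∈ Λ′_{j′}`, `uavgZ L 1 τ_Z j′ y = ι((R̄^{j′}(g₁·g₂⁻¹))(π_{j′}(y + c_{k−j′}𝟙)))` — the (78) families of `τ_Z` under the cell are within `4ω·θ^{j′−(i+1)} < δ_N` of `1` (✓p753816).
[cite: Balaban1985Averaging, (78)–(81) p.30; Balaban1987RG1, (0.3)–(0.4) pp.252–253; Balaban1985RegularSpaces, (1.29) p.81] -/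
theorem uavgZ_tau_eq_gaugeAvgIter_at_cell {K K' : ℕ} {Ω' : ℕ → Set (B7Prop1Explicit.Site (F.P K).d)} (c : CubeB8DZ (F.P K).d (F.P K).L K' Ω')
    (hk : c.k ≤ (F.P K).m + (F.P K).K) (U : GaugeField (F.P K) 0 (SU N)) (g₁ g₂ : GaugeTransf (F.P K) 0 (SU N))
    (hax₁ : ∀ n, n < c.k → AxialGauge (symCd F N K n) (Averaging.iter (avOfRecord F N K) n (gaugeAct g₁ U)))
    (hax₂ : ∀ n, n < c.k → AxialGauge (radialContourData (F.P K) n (SU N)) (Averaging.iter (avOfRecord F N K) n (gaugeAct g₂ U)))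
    (hN : ∀ n, n < c.k → (F.P K).L < (F.P K).sitesPerDir n)
    {a₀ : ℝ} (ha₀ : 0 ≤ a₀) {Ωc : Set (Site (F.P K) 0)} (hU : PlaqSmallOn (plaqsOf Ωc) a₀ U)
    (hcollar : cover (F.P K) '' tcube (F.P K).L c.a c.M c.ρ c.k ⊆ Ωc)
    (a : ℕ → ℝ) (ha : ∀ n, 0 ≤ a n)
    (hbud : ∀ n, n < c.k →
      6400 * ((((F.P K).d + 2) * (F.P K).L : ℕ) : ℝ) ^ 2 * ((F.P K).L : ℝ) ^ (n + 1) * (((((F.P K).d - 1 : ℕ) : ℝ)) * ((((F.P K).L ^ (n + 1) - 1 : ℕ) : ℝ)) * a₀) ≤ 1)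
    (hgd : ∀ n, n < c.k →
      30 * ((((F.P K).d + 2) * (F.P K).L : ℕ) : ℝ) ^ 2 * ((F.P K).L : ℝ) ^ (n + 1) * (((((F.P K).d - 1 : ℕ) : ℝ)) * ((((F.P K).L ^ (n + 1) - 1 : ℕ) : ℝ)) * a₀) < deltaSU (Fin N))
    (haa : ∀ n, n < c.k →
      120 * ((((F.P K).d + 2) * (F.P K).L : ℕ) : ℝ) * ((F.P K).L : ℝ) ^ n * (((((F.P K).d - 1 : ℕ) : ℝ)) * ((((F.P K).L ^ (n + 1) - 1 : ℕ) : ℝ)) * a₀) < a n)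
    (h100 : ∀ n, n < c.k → 2 * ((((F.P K).d * (((F.P K).L - 1) / 2) : ℕ) : ℝ) * (((((F.P K).d - 1 : ℕ) : ℝ) * (((F.P K).L - 1 : ℕ) : ℝ)) * a n)) ≤ 1 / 100)
    (hguard : ∀ n, n < c.k →
      2 * ((((F.P K).d * (((F.P K).L - 1) / 2) : ℕ) : ℝ) * (((((F.P K).d - 1 : ℕ) : ℝ) * (((F.P K).L - 1 : ℕ) : ℝ)) * a n)) < (FederbushMean.federbushSU (n := Fin N)).δ)
    {ω θ : ℝ} (hθ0 : 0 ≤ θ) (hθ : θ ≤ 1 / 8) (hω0 : 0 ≤ ω) (hω : ω ≤ 1 / 128) (hδ : 4 * ω < deltaSU (Fin N))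
    (hE : ∀ m, m < c.k → 4 * (2 * ((((F.P K).d * (((F.P K).L - 1) / 2) : ℕ) : ℝ) * (((((F.P K).d - 1 : ℕ) : ℝ) * (((F.P K).L - 1 : ℕ) : ℝ)) * a m))) ≤
      ω / 2 * θ ^ (c.k - (m + 1)))
    {j : ℕ} (hjk : j ≤ c.k) {y : Pt (F.P K).d} (hy : y ∈ c.lamS j) :
    letI : CStarAlgebra (MatA N) := {}
    uavgZ (F.P K).L (1 : Pt (F.P K).d → Fin (F.P K).d → (MatA N)ˣ)
        (fun x => ιSU N ((fun x' => g₁ x' * (g₂ x')⁻¹) (cover (F.P K) (x + fun _ => ((ctrShift (F.P K).L c.k : ℕ) : ℤ))))) j y =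
      ιSU N (gaugeAvgIter (loopAvgBlockOp expMeanLogSU) (fun x' => g₁ x' * (g₂ x')⁻¹) j (coverAt (F.P K) j (y + fun _ => ((ctrShift (F.P K).L (c.k - j) : ℕ) : ℤ)))) := by
  letI : CStarAlgebra (MatA N) := {}
  have hL := (F.P K).hL.1
  have hθ2 : θ ≤ 1 / 2 := hθ.trans (by norm_num)
  have hθ1 : θ ≤ 1 := hθ.trans (by norm_num)
  set τZ : Pt (F.P K).d → (MatA N)ˣ := (fun x => ιSU N ((fun x' => g₁ x' * (g₂ x')⁻¹) (cover (F.P K) (x + fun _ => ((ctrShift (F.P K).L c.k : ℕ) : ℤ))))) with hτZ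
  have hptτ := hpt_lift_at_recordCube_cell N c hk U g₁ g₂ hax₁ hax₂ hN ha₀ hU hcollar a ha hbud hgd haa h100 hguard hθ0 hθ2 hω0 hE hjk hy
  have hτu : ∀ x, UnderZ (F.P K).L j y x → τZ x ∈ unitaryUnits (MatA N) := lift_mem_unitaryUnits_under N (fun x' => g₁ x' * (g₂ x')⁻¹) c.k j y
  have hrows := osc_rows_of_pointwise_under hL τZ j y hθ0 hθ hω0 hω hτu hptτ
  refine uavgZ_one_coverLift_eq_gaugeAvgIter_under_of_small N hk (fun x' => g₁ x' * (g₂ x')⁻¹) hjk y fun i hi z hz r => ?_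
  have h := hrows i hi z hz _ (mem_blockSitesZ.2 ⟨r, rfl⟩)
  rw [← Units.val_mul] at h
  have hθi : θ ^ (j - (i + 1)) ≤ 1 := pow_le_one₀ hθ0 hθ1
  have : 4 * ω * θ ^ (j - (i + 1)) ≤ 4 * ω := by
    have h0 : 0 ≤ 4 * ω := by positivity
    nlinarith
  exact lt_of_le_of_lt (h.trans this) hδ

/-! ## §3  The `(h, X, ω)` package of the junction's `hJ` -/

/-- ★★★ **THE JUNCTION's BLOCK-CONSTANT DATUM**: under the hypotheses of §2 (`4ω < δ_N`), there is `h : ℤᵈ → M_N(ℂ)ˣ` with: `h` special-unitary-valued; `h = 1` off `Ω′₀ = c.sq 0`;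
`h = R̄₀^{j′}τ(y)` (`= uavgZ L 1 τ_Z j′ y`) under EVERY dented cell `y ∈ Λ′_{j′}`, `j′ ≤ c.k` (n05-e ✓p748893's lift of the cell datum — the dented cells' towers are disjoint); `‖h(x) − 1‖ ≤ 9ω`
everywhere; and hence the two oscillation rows of the pre-composed crown with `18ω`: `‖h(L^{j′}z) − h(L^{j′}(z + e_μ))‖ ≤ 18ω` for ALL `j′, z, μ` and `‖h(x) − h(x + e_μ)‖ ≤ 18ω` for ALL
bonds — `hJ`'s `hoscj`∕`hosc0` (✓p760315) follow by dropping their box ∕ side premises.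
[cite: Balaban1985Averaging, (78)–(81) p.30, (167) p.44; Balaban1985RegularSpaces, (1.29) p.81, (1.131) p.99, p.98; Balaban1985Variational, (147)–(152) p.301; Balaban1987RG1, (0.3)–(0.4) pp.252–253, (0.21) p.256] -/
theorem exists_junction_blockConstant_datum {K K' : ℕ} {Ω' : ℕ → Set (B7Prop1Explicit.Site (F.P K).d)} (c : CubeB8DZ (F.P K).d (F.P K).L K' Ω')
    (hk : c.k ≤ (F.P K).m + (F.P K).K) (U : GaugeField (F.P K) 0 (SU N)) (g₁ g₂ : GaugeTransf (F.P K) 0 (SU N))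
    (hax₁ : ∀ n, n < c.k → AxialGauge (symCd F N K n) (Averaging.iter (avOfRecord F N K) n (gaugeAct g₁ U)))
    (hax₂ : ∀ n, n < c.k → AxialGauge (radialContourData (F.P K) n (SU N)) (Averaging.iter (avOfRecord F N K) n (gaugeAct g₂ U)))
    (htop : ∀ yT : Site (F.P K) c.k, g₁ (embIter c.k yT) * (g₂ (embIter c.k yT))⁻¹ = 1)
    (hN : ∀ n, n < c.k → (F.P K).L < (F.P K).sitesPerDir n)
    {a₀ : ℝ} (ha₀ : 0 ≤ a₀) {Ωc : Set (Site (F.P K) 0)} (hU : PlaqSmallOn (plaqsOf Ωc) a₀ U)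
    (hcollar : cover (F.P K) '' tcube (F.P K).L c.a c.M c.ρ c.k ⊆ Ωc)
    (a : ℕ → ℝ) (ha : ∀ n, 0 ≤ a n)
    (hbud : ∀ n, n < c.k →
      6400 * ((((F.P K).d + 2) * (F.P K).L : ℕ) : ℝ) ^ 2 * ((F.P K).L : ℝ) ^ (n + 1) * (((((F.P K).d - 1 : ℕ) : ℝ)) * ((((F.P K).L ^ (n + 1) - 1 : ℕ) : ℝ)) * a₀) ≤ 1)
    (hgd : ∀ n, n < c.k →
      30 * ((((F.P K).d + 2) * (F.P K).L : ℕ) : ℝ) ^ 2 * ((F.P K).L : ℝ) ^ (n + 1) * (((((F.P K).d - 1 : ℕ) : ℝ)) * ((((F.P K).L ^ (n + 1) - 1 : ℕ) : ℝ)) * a₀) < deltaSU (Fin N))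
    (haa : ∀ n, n < c.k →
      120 * ((((F.P K).d + 2) * (F.P K).L : ℕ) : ℝ) * ((F.P K).L : ℝ) ^ n * (((((F.P K).d - 1 : ℕ) : ℝ)) * ((((F.P K).L ^ (n + 1) - 1 : ℕ) : ℝ)) * a₀) < a n)
    (h100 : ∀ n, n < c.k → 2 * ((((F.P K).d * (((F.P K).L - 1) / 2) : ℕ) : ℝ) * (((((F.P K).d - 1 : ℕ) : ℝ) * (((F.P K).L - 1 : ℕ) : ℝ)) * a n)) ≤ 1 / 100)
    (hguard : ∀ n, n < c.k →
      2 * ((((F.P K).d * (((F.P K).L - 1) / 2) : ℕ) : ℝ) * (((((F.P K).d - 1 : ℕ) : ℝ) * (((F.P K).L - 1 : ℕ) : ℝ)) * a n)) < (FederbushMean.federbushSU (n := Fin N)).δ)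
    {ω θ : ℝ} (hθ0 : 0 ≤ θ) (hθ : θ ≤ 1 / 8) (hω0 : 0 ≤ ω) (hω : ω ≤ 1 / 128) (hδ : 4 * ω < deltaSU (Fin N))
    (hE : ∀ m, m < c.k → 4 * (2 * ((((F.P K).d * (((F.P K).L - 1) / 2) : ℕ) : ℝ) * (((((F.P K).d - 1 : ℕ) : ℝ) * (((F.P K).L - 1 : ℕ) : ℝ)) * a m))) ≤
      ω / 2 * θ ^ (c.k - (m + 1))) :
    letI : CStarAlgebra (MatA N) := {}
    ∃ h : Pt (F.P K).d → (MatA N)ˣ,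
      (∀ x, h x ∈ specialUnitaryUnits (Fin N)) ∧
      (∀ x, x ∉ c.sq 0 → h x = 1) ∧
      (∀ j', j' ≤ c.k → ∀ y ∈ c.lamS j', ∀ x, UnderZ (F.P K).L j' y x →
        h x = uavgZ (F.P K).L (1 : Pt (F.P K).d → Fin (F.P K).d → (MatA N)ˣ)
          (fun x => ιSU N ((fun x' => g₁ x' * (g₂ x')⁻¹) (cover (F.P K) (x + fun _ => ((ctrShift (F.P K).L c.k : ℕ) : ℤ))))) j' y) ∧
      (∀ x, ‖((h x : (MatA N)ˣ) : MatA N) - 1‖ ≤ 9 * ω) ∧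
      (∀ (j' : ℕ) (z : Pt (F.P K).d) (μ : Fin (F.P K).d),
        ‖((uLev (F.P K).L h j' z : (MatA N)ˣ) : MatA N) - ((uLev (F.P K).L h j' (z + e μ) : (MatA N)ˣ) : MatA N)‖ ≤ 18 * ω) ∧
      (∀ (x : Pt (F.P K).d) (μ : Fin (F.P K).d), ‖((h x : (MatA N)ˣ) : MatA N) - ((h (x + e μ) : (MatA N)ˣ) : MatA N)‖ ≤ 18 * ω) := by
  letI : CStarAlgebra (MatA N) := {}
  have hL := (F.P K).hL.1
  set τZ : Pt (F.P K).d → (MatA N)ˣ := (fun x => ιSU N ((fun x' => g₁ x' * (g₂ x')⁻¹) (cover (F.P K) (x + fun _ => ((ctrShift (F.P K).L c.k : ℕ) : ℤ))))) with hτZ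
  set X : ℕ → Pt (F.P K).d → (MatA N)ˣ := fun j' y => uavgZ (F.P K).L (1 : Pt (F.P K).d → Fin (F.P K).d → (MatA N)ˣ) τZ j' y with hX
  obtain ⟨h, hcst, -, hoff, hval⟩ := exists_blockConstant_dented hL c X
  -- the data at dented cells: special-unitary and within `9ω` of `1`
  have hXSU : ∀ j', j' ≤ c.k → ∀ y ∈ c.lamS j', X j' y ∈ specialUnitaryUnits (Fin N) := fun j' hj' y hy => by
    simp only [hX]
    rw [uavgZ_tau_eq_gaugeAvgIter_at_cell N c hk U g₁ g₂ hax₁ hax₂ hN ha₀ hU hcollar a ha hbud hgd haa h100 hguard hθ0 hθ hω0 hω hδ hE hj' hy]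
    exact ιSU_mem_specialUnitaryUnits N _
  have hXnear : ∀ j', j' ≤ c.k → ∀ y ∈ c.lamS j', ‖((X j' y : (MatA N)ˣ) : MatA N) - 1‖ ≤ 9 * ω := fun j' hj' y hy =>
    (uavgZ_tau_unitary_and_near_one_at_cell N c hk U g₁ g₂ hax₁ hax₂ htop hN ha₀ hU hcollar a ha hbud hgd haa h100 hguard hθ0 hθ hω0 hω hE hj' hy).2
  have hnear : ∀ x, ‖((h x : (MatA N)ˣ) : MatA N) - 1‖ ≤ 9 * ω := fun x => by
    rcases hval x with h1 | ⟨j', hj', y, hy, hxy⟩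
    · rw [h1, Units.val_one, sub_self, norm_zero]; positivity
    · rw [hxy]; exact hXnear j' hj' y hy
  have hpair : ∀ x x' : Pt (F.P K).d, ‖((h x : (MatA N)ˣ) : MatA N) - ((h x' : (MatA N)ˣ) : MatA N)‖ ≤ 18 * ω := fun x x' => by
    have e1 : ((h x : (MatA N)ˣ) : MatA N) - ((h x' : (MatA N)ˣ) : MatA N) = (((h x : (MatA N)ˣ) : MatA N) - 1) - (((h x' : (MatA N)ˣ) : MatA N) - 1) := by abel
    rw [e1]
    have := hnear x
    have := hnear x'
    linarith [norm_sub_le (((h x : (MatA N)ˣ) : MatA N) - 1) (((h x' : (MatA N)ˣ) : MatA N) - 1)]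
  refine ⟨h, fun x => ?_, hoff, hcst, hnear, fun j' z μ => ?_, fun x μ => hpair x (x + e μ)⟩
  · rcases hval x with h1 | ⟨j', hj', y, hy, hxy⟩
    · rw [h1]; exact (specialUnitaryUnits (Fin N)).one_mem
    · rw [hxy]; exact hXSU j' hj' y hy
  · simp only [B7AvgGaugeCovariance.uLev_apply]
    exact hpair _ _

end Summit.QuantumFields.YangMills.BalabanUVNodes.N07JunctionBlockConstantDatum

end
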